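import Summits.FinalStateConjecture.FinalStateConjecture.Theorems.ZeroEnergyKerrOrBombStationaryLimitReductionKerrIsometryRigidityWave3
import Summits.FinalStateConjecture.FinalStateConjecture.Theorems.ZeroEnergyKerrOrBombStationaryLimitReductionKerrIsometryRigidityWave3EndMatchingCore
import HarnessLib

/-!
# Route ZeroEnergyKerrOrBomb · crux `StationaryLimitReduction` (stmt-FinalStateConjecture-10021), line
# `symplectic-dual-of-the-bomb` — stub 1R `kerrIsometryRigidity`, wave 3: END MATCHING PROVED from the
# Killing algebras, and the reduction of the registered statement to F3 + F4

Helper file (`--supports stmt-FinalStateConjecture-10021`; registered helpers `kerrEndMatching_of_killingAlgebras`,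
`stub_kerrIsometryRigidity_of_extension_and_rigidity`) of the lead's wave-3 stub-worker for
`stub_kerrIsometryRigidity : Sig4.stub_kerrIsometryRigidity` (lead prover-line-stmt-FinalStateConjecture-10021-a2-0,
2026-08-16). Last of the end-matching files: it feeds the explicit Killing fields supplied by the Literature facts
`ONeill1995_kerrKillingFields` (`a ≠ 0`) and `StephaniEtAl2003_schwarzschildKillingFields` (`a = 0`) into the
topological core `far_of_explicitField` (`…Wave3EndMatchingCore`), proving obligation F0 `KerrEndMatching` of
`…Wave3Facts`, and combines it with the reduction `stub_kerrIsometryRigidity_of_horizonExtension` (`…Wave3`).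

* §6 `Kerr.fderiv_radius_apply_eq_zero`: vectors `δ`-orthogonal to `x⃗` with `a v³ = 0` annihilate the Kerr–Schild
  radius (evenness of `s ↦ r(x + s v)`);
* §7 the norms of the explicit fields: `g(K_{α,β}, K_{α,β}) (P² − a²u) = u(αa − βP)² ≥ 0` on `{r = r₊}`
  (`bilin_killingCombination_nonneg_of_radius_eq_rPlus`), `g(β∂_φ, β∂_φ) ≥ 0`, and for Schwarzschild
  `g(α∂_t + (0, W₀x⃗), ·) = −α² + ‖W₀x⃗‖² + (2M/r)α²` (`bilin_rotationField`);
* §8 `kerrEndMatching_of_killingAlgebras` (registered): the two facts imply `KerrEndMatching`;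
  `stub_kerrIsometryRigidity_of_extension_and_rigidity` (registered): the three printed facts, the horizon
  extension F3 (`KerrHorizonExtension`) and the asymptotic rigidity F4 (`KerrAsymptoticRigidity`) imply
  `Sig4.stub_kerrIsometryRigidity`.

References: P. T. Chruściel, J. L. Costa, arXiv:0806.0016, Thm. 1.3, §2.2; B. O'Neill, *The Geometry of Kerr
Black Holes* (1995), Ch. 2 §2.4–2.5, Ch. 3 Cor. 3.7.4; M. Dafermos, I. Rodnianski, arXiv:0811.0354, §5.1–5.2;
H. Stephani et al., *Exact Solutions of Einstein's Field Equations* (2003), §15.4, §38.2; M. Visser,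
arXiv:0706.0622, (34)–(35).
-/

set_option linter.dupNamespace false

noncomputable section

open scoped Manifold ContDiff Topology RealInnerProductSpace
open Set Filter Function

namespace Summit.FinalStateConjecture.FinalStateConjecture.Theorems.SymplecticDualOfTheBomb

open Summit.FinalStateConjecture.FinalStateConjecture.Theorems.OneLockedExplosion
open Literature.Geometry.Lorentzian Literature.Geometry.Manifold

/-! ## §6 The Kerr–Schild radius is annihilated by vectors tangent to its level ellipsoids -/

section Radius

/-- The Kerr–Schild radius depends on `x` only through `‖x⃗‖` and `x³` (definitional). [folklore] -/
theorem _root_.Literature.Geometry.Lorentzian.Kerr.radius_congr {a : ℝ} {x y : E4}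
    (h1 : E4.spatialNorm x = E4.spatialNorm y) (h2 : x 3 = y 3) : Kerr.radius a x = Kerr.radius a y := by
  simp only [Kerr.radius, h1, h2]

/-- **`dr(v) = 0` for `v⃗ ⊥ x⃗` with `a = 0` or `v³ = 0`** (at points with `r > 0`): `s ↦ r(x + s v)` is even
(the radius depends on `‖x⃗ + s v⃗‖² = ‖x⃗‖² + s² ‖v⃗‖²` and on `x³ + s v³`; for `a = 0`, `r = ‖x⃗‖`), hence has
zero derivative at `s = 0`, which is `dr_x(v)` by the chain rule. So `∂_{t*}`, the axial field `x¹∂₂ − x²∂₁`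
and, for `a = 0`, every rotation field `(0, W₀ x⃗)`, `W₀ ∈ so(3)`, annihilate `r`. Visser arXiv:0706.0622, (35).
[folklore] -/
theorem _root_.Literature.Geometry.Lorentzian.Kerr.fderiv_radius_apply_eq_zero {a : ℝ} {x : E4}
    (hx : 0 < Kerr.radius a x) {v : E4} (hv : ⟪E4.spatial x, E4.spatial v⟫ = 0) (hv3 : a = 0 ∨ v 3 = 0) :
    fderiv ℝ (Kerr.radius a) x v = 0 := by
  set f : ℝ → ℝ := fun s ↦ Kerr.radius a (x + s • v) with hf
  -- `f` is even
  have hsq : ∀ s : ℝ, E4.spatialNorm (x + s • v) ^ 2 = E4.spatialNorm x ^ 2 + s ^ 2 * ‖E4.spatial v‖ ^ 2 := by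
    intro s
    rw [E4.spatialNorm, E4.spatialNorm, map_add, map_smul, norm_add_sq_real, real_inner_smul_right, hv,
      norm_smul, Real.norm_eq_abs, mul_pow, sq_abs]
    ring
  have hsN : ∀ s : ℝ, E4.spatialNorm (x + (-s) • v) = E4.spatialNorm (x + s • v) := by
    intro s
    have h1 := hsq s
    have h2 := hsq (-s)
    rw [neg_sq] at h2
    nlinarith [E4.spatialNorm_nonneg (x + (-s) • v), E4.spatialNorm_nonneg (x + s • v)]
  have heven : ∀ s : ℝ, f (-s) = f s := by
    intro s
    rcases hv3 with ha | h3
    · subst ha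
      show Kerr.radius 0 (x + (-s) • v) = Kerr.radius 0 (x + s • v)
      rw [Kerr.radius_zero_left, Kerr.radius_zero_left, hsN]
    · show Kerr.radius a (x + (-s) • v) = Kerr.radius a (x + s • v)
      refine Kerr.radius_congr (hsN s) ?_
      simp [h3]
  -- its derivative at `0` is `dr_x(v)`, that of `s ↦ f (−s)` is the negative
  have hd : DifferentiableAt ℝ (Kerr.radius a) x :=
    (Kerr.contDiffAt_radius hx (n := 1)).differentiableAt one_ne_zero
  have hline : HasDerivAt (fun s : ℝ ↦ x + s • v) v 0 := by
    simpa using ((hasDerivAt_id (0 : ℝ)).smul_const v).const_add x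
  have h1 : HasDerivAt f (fderiv ℝ (Kerr.radius a) x v) 0 :=
    hd.hasFDerivAt.comp_hasDerivAt_of_eq (0 : ℝ) hline (by simp)
  have h1' : HasDerivAt f (fderiv ℝ (Kerr.radius a) x v) (-(0 : ℝ)) := by rw [neg_zero]; exact h1
  have h2 : HasDerivAt (fun s : ℝ ↦ f (-s)) (fderiv ℝ (Kerr.radius a) x v * -1) 0 :=
    h1'.comp (0 : ℝ) (hasDerivAt_neg (0 : ℝ))
  have h3 : (fun s : ℝ ↦ f (-s)) = f := funext heven
  rw [h3] at h2
  linarith [h1.unique h2]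

end Radius

/-! ## §7 The explicit Killing fields: norms on the horizon and in the degenerate case -/

section Norms

open Literature.Barriers.FinalStateConjecture

/-- **`g_{M,a}(K_{α,β}, K_{α,β}) ≥ 0` on `{r = r₊}`** (`a² ≤ M²`, `M > 0`): at a point of a Kerr–Schild chart with
`r = r₊`, writing `u = x₁² + x₂²`, `P = r₊² + a² = 2Mr₊`, one has `2H = P²/(P² − a²u)` and
`g(K, K) (P² − a²u) = u (αa − βP)² ≥ 0` (the span of `∂_{t*}, ∂_φ` is degenerate on the event horizon, with
null direction `∂_{t*} + (a/2Mr₊) ∂_φ`; `M > 0` is not needed). O'Neill 1995, Ch. 2, §2.4–2.5; Dafermos–Rodnianski arXiv:0811.0354,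
§5.2.1. [folklore] -/
theorem bilin_killingCombination_nonneg_of_radius_eq_rPlus {M a : ℝ} (h : a ^ 2 ≤ M ^ 2)
    {r₀ : ℝ} (x : Kerr.region a r₀) (hx : Kerr.radius a x.1 = Kerr.rPlus M a) (α β : ℝ) :
    0 ≤ Kerr.bilin M a x.1 (killingCombination a r₀ α β x) (killingCombination a r₀ α β x) := by
  have hr : 0 < Kerr.radius a x.1 := Kerr.radius_pos_of_mem_region x.2
  have hs := sq_add_sq_eq a r₀ x
  have hP := rPlus_sq_add_sq h
  rw [Kerr.bilin_apply, minkowski_killingCombination, nullCovector_killingCombination, Kerr.scalarH]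
  rw [hx] at hs hr ⊢
  set r := Kerr.rPlus M a with hr_def
  set u := (x.1 1) ^ 2 + (x.1 2) ^ 2 with hu_def
  set z := x.1 3 with hz_def
  set P := r ^ 2 + a ^ 2 with hP_def
  have hPpos : 0 < P := by positivity
  have hu0 : 0 ≤ u := by positivity
  have hr2 : (0 : ℝ) < r ^ 2 := by positivity
  have hz : P * z ^ 2 = r ^ 2 * (P - u) := by
    have h1 : u * r ^ 2 = P * (r ^ 2 - z ^ 2) := by
      rw [hs]; field_simp
    linear_combination h1
  have huP : u ≤ P := by nlinarith [sq_nonneg z, mul_nonneg hPpos.le (sq_nonneg z)]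
  have haP : a ^ 2 < P := by rw [hP_def]; linarith
  have hD : 0 < P ^ 2 - a ^ 2 * u := by nlinarith [mul_nonneg (sq_nonneg a) hu0]
  set D := P ^ 2 - a ^ 2 * u with hD_def
  have hden : r ^ 4 + a ^ 2 * z ^ 2 = r ^ 2 * D / P := by
    rw [hD_def]
    field_simp
    linear_combination (a ^ 2) * hz
  have e1 : M * r ^ 3 = P / 2 * r ^ 2 := by linear_combination (-(r ^ 2 / 2)) * hP
  have hD' : D ≠ 0 := hD.ne'
  have hr' : r ≠ 0 := hr.ne'
  have hP' : P ≠ 0 := hPpos.ne'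
  have key : (-α ^ 2 + β ^ 2 * u + 2 * (M * r ^ 3 / (r ^ 4 + a ^ 2 * z ^ 2)) *
      ((α - β * a * u / P) * (α - β * a * u / P))) * D = u * (α * a - β * P) ^ 2 := by
    rw [hden, e1]
    field_simp
    rw [hD_def]
    ring
  exact nonneg_of_mul_nonneg_left (key ▸ mul_nonneg hu0 (sq_nonneg _)) hD

/-- **`g_{M,a}(β ∂_φ, β ∂_φ) ≥ 0`** on every Kerr–Schild chart with `M ≥ 0`: `g ≥ η` on `∂_φ` (`2Hℓ(·)² ≥ 0`) and
`η(β∂_φ, β∂_φ) = β²(x₁² + x₂²)`. O'Neill 1995, Ch. 2, §2.4. [folklore] -/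
theorem bilin_killingCombination_zero_nonneg {M a : ℝ} (hM : 0 ≤ M) {r₀ : ℝ} (x : Kerr.region a r₀) (β : ℝ) :
    0 ≤ Kerr.bilin M a x.1 (killingCombination a r₀ 0 β x) (killingCombination a r₀ 0 β x) := by
  rw [Kerr.bilin_apply, minkowski_killingCombination]
  have hH : 0 ≤ Kerr.scalarH M a x.1 := Kerr.scalarH_nonneg hM a _
  nlinarith [mul_nonneg (mul_nonneg zero_le_two hH)
    (mul_self_nonneg (Kerr.nullCovector a x.1 (killingCombination a r₀ 0 β x))),
    mul_nonneg (sq_nonneg β) (add_nonneg (sq_nonneg (x.1 1)) (sq_nonneg (x.1 2)))]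

/-- The Schwarzschild Kerr–Schild null covector: `ℓ(v) = v⁰ + ⟨x⃗, v⃗⟩/r` for `a = 0`, `r = ‖x⃗‖ ≠ 0`
(`ℓ = (1, x⃗/r)`). Dafermos–Rodnianski arXiv:0811.0354, §5.1. [folklore] -/
theorem _root_.Literature.Geometry.Lorentzian.Kerr.nullCovector_zero_apply {x : E4} (hx : Kerr.radius 0 x ≠ 0)
    (v : E4) : Kerr.nullCovector 0 x v = v 0 + ⟪E4.spatial x, E4.spatial v⟫ / Kerr.radius 0 x := by
  have hinner : ⟪E4.spatial x, E4.spatial v⟫ = x 1 * v 1 + x 2 * v 2 + x 3 * v 3 := by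
    rw [real_inner_comm, PiLp.inner_apply]
    simp [Fin.sum_univ_three, E4.spatial_apply]
  rw [hinner]
  simp [Kerr.nullCovector, Kerr.nullCovectorFun, Fin.sum_univ_four]
  field_simp
  ring

/-- A skew-adjoint endomorphism has `⟨y, W₀ y⟩ = 0`. [folklore] -/
theorem inner_skew_self {W₀ : E3 →L[ℝ] E3} (hW : ∀ u v : E3, ⟪W₀ u, v⟫ = -⟪u, W₀ v⟫) (y : E3) :
    ⟪y, W₀ y⟫ = 0 := by
  have h := hW y y
  rw [real_inner_comm] at h
  linarith

/-- **The norm of `α ∂_t + (0, W₀ x⃗)`, `W₀ ∈ so(3)`, in the Schwarzschild Kerr–Schild chart**: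
`g(Y, Y) = −α² + ‖W₀ x⃗‖² + (2M/r) α²` (`ℓ(Y) = α`, `⟨x⃗, W₀ x⃗⟩ = 0`; `H = M/r`). Stephani et al. 2003, §15.4.
[folklore] -/
theorem bilin_rotationField {M : ℝ} {x : E4} (hx : 0 < Kerr.radius 0 x) {W₀ : E3 →L[ℝ] E3}
    (hW : ∀ u v : E3, ⟪W₀ u, v⟫ = -⟪u, W₀ v⟫) (α : ℝ) :
    Kerr.bilin M 0 x (α • E4.basisVector 0 + E4.ofTimeSpace 0 (W₀ (E4.spatial x)))
        (α • E4.basisVector 0 + E4.ofTimeSpace 0 (W₀ (E4.spatial x))) =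
      -α ^ 2 + ‖W₀ (E4.spatial x)‖ ^ 2 + 2 * (M / Kerr.radius 0 x) * α ^ 2 := by
  have hℓ : Kerr.nullCovector 0 x (α • E4.basisVector 0 + E4.ofTimeSpace 0 (W₀ (E4.spatial x))) = α := by
    rw [Kerr.nullCovector_zero_apply hx.ne', map_add, map_smul, E4.spatial_basisVector_zero, smul_zero,
      zero_add, E4.spatial_ofTimeSpace, inner_skew_self hW, zero_div, add_zero]
    simp [E4.basisVector]
  have hH : Kerr.scalarH M 0 x = M / Kerr.radius 0 x := by
    unfold Kerr.scalarH
    have hr : Kerr.radius 0 x ≠ 0 := hx.ne'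
    field_simp
    ring
  rw [Kerr.bilin_apply, minkowski_bilin_smul_basisVector_add_ofTimeSpace, hℓ, hH]
  ring

end Norms

/-! ## §8 End matching from the two Killing-algebra facts; the reduction without F0 -/

/-- **Registered helper `kerrEndMatching_of_killingAlgebras`: obligation F0 (`KerrEndMatching`) PROVED from the
Killing algebras of Kerr and Schwarzschild.** For `a ≠ 0` the pulled-back Killing field `Y = Ψ^*T` is
`α ∂_{t*} + β ∂_φ` (`ONeill1995_kerrKillingFields`), for `a = 0` it is `α ∂_t + (0, W₀ x⃗)`
(`StephaniEtAl2003_schwarzschildKillingFields`); both extend to explicit continuous fields with constant time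
component which annihilate `r` (`Kerr.fderiv_radius_apply_eq_zero`), have non-negative norm on `{r = r₊}`
(`bilin_killingCombination_nonneg_of_radius_eq_rPlus`, `bilin_rotationField` with `r₊ = 2M`) and on the exterior
when `α = 0`; `far_of_explicitField` concludes. Chruściel–Costa arXiv:0806.0016, Thm. 1.3, §2.2; O'Neill 1995,
Cor. 3.7.4; Stephani et al. 2003, §38.2. [folklore] -/
theorem kerrEndMatching_of_killingAlgebras : ONeill1995_kerrKillingFields → StephaniEtAl2003_schwarzschildKillingFields → KerrEndMatching := by
  intro hF1 hF1' _ 𝓑 A M a Ψ htel hreg hhor hcart hschw hMa hΨi hΨr hΨiso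
  haveI : 𝓑.metric.HasLeviCivita := 𝓑.metric.toPseudoRiemannianMetric.hasLeviCivita
  haveI hKLC : (Kerr.smoothMetric M a (Kerr.rPlus M a)).HasLeviCivita :=
    (Kerr.smoothMetric M a (Kerr.rPlus M a)).toPseudoRiemannianMetric.hasLeviCivita
  have hne : 𝓑.horizon.Nonempty := htel.2.1.nonempty
  set Y := VectorField.mpullback 𝓘(ℝ, E4) (𝓡 4) Ψ 𝓑.killing with hY_def
  have hYK := isKillingField_mpullback_killing (𝓑 := 𝓑) (M := M) (a := a) (Ψ := Ψ) hΨiso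
  have ha2 : a ^ 2 ≤ M ^ 2 := (sq_lt_sq' (abs_lt.1 hMa).1 (abs_lt.1 hMa).2).le
  by_cases ha : a = 0
  · -- Schwarzschild: `Y = α ∂_t + (0, W₀ x⃗)`
    subst ha
    obtain ⟨α, W₀, hW, hXW⟩ := hF1' M hMa.pos Y hYK
    have h2M : Kerr.rPlus M 0 = 2 * M := Kerr.rPlus_zero_right hMa.pos.le
    refine far_of_explicitField 𝓑 A M 0 Ψ (fun x ↦ α • E4.basisVector 0 + E4.ofTimeSpace 0 (W₀ (E4.spatial x)))
      α hne hhor hcart hschw hMa hΨi hΨr hΨiso (fun x ↦ hXW x) ?_ ?_ ?_ ?_ ?_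
    · exact (continuous_const.add ((E4.continuous_ofTimeSpace 0).comp (W₀.continuous.comp E4.spatial.continuous)))
    · intro x; simp [E4.basisVector]
    · intro x hx
      refine Kerr.fderiv_radius_apply_eq_zero (Kerr.radius_pos_of_mem_region hx) ?_ (Or.inl rfl)
      rw [map_add, map_smul, E4.spatial_basisVector_zero, smul_zero, zero_add, E4.spatial_ofTimeSpace]
      exact inner_skew_self hW _
    · intro x hx
      have hr : 0 < Kerr.radius 0 x := by rw [hx, h2M]; linarith [hMa.pos]
      rw [bilin_rotationField hr hW, hx, h2M]
      have : 2 * (M / (2 * M)) * α ^ 2 = α ^ 2 := by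
        have hM : M ≠ 0 := hMa.pos.ne'
        field_simp
      rw [this]
      nlinarith [sq_nonneg ‖W₀ (E4.spatial x)‖]
    · intro hα0 x hx
      subst hα0
      have hr : 0 < Kerr.radius 0 x := Kerr.radius_pos_of_mem_region hx
      rw [bilin_rotationField hr hW]
      nlinarith [sq_nonneg ‖W₀ (E4.spatial x)‖]
  · -- Kerr `a ≠ 0`: `Y = α ∂_{t*} + β ∂_φ`
    obtain ⟨α, β, hαβ⟩ := hF1 M a ha hMa Y hYK
    refine far_of_explicitField 𝓑 A M a Ψ
      (fun x ↦ α • E4.basisVector 0 + β • ((x 1) • E4.basisVector 2 - (x 2) • E4.basisVector 1))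
      α hne hhor hcart hschw hMa hΨi hΨr hΨiso (fun x ↦ hαβ x) ?_ ?_ ?_ ?_ ?_
    · fun_prop
    · intro x; simp [E4.basisVector]
    · intro x hx
      refine Kerr.fderiv_radius_apply_eq_zero (Kerr.radius_pos_of_mem_region hx) ?_ (Or.inr ?_)
      · rw [real_inner_comm, PiLp.inner_apply]
        simp [Fin.sum_univ_three, E4.spatial_apply, E4.basisVector]
        ring
      · simp [E4.basisVector]
    · intro x hx
      have hr : 0 < Kerr.radius a x := by
        rw [hx]; unfold Kerr.rPlus; linarith [hMa.pos, Real.sqrt_nonneg (M ^ 2 - a ^ 2)]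
      have hx0 : x ∈ Kerr.region a 0 := by rw [Kerr.mem_region, max_self]; exact hr
      exact bilin_killingCombination_nonneg_of_radius_eq_rPlus ha2 (⟨x, hx0⟩ : Kerr.region a 0) hx α β
    · intro hα0 x hx
      subst hα0
      exact bilin_killingCombination_zero_nonneg hMa.pos.le (⟨x, hx⟩ : Kerr.region a (Kerr.rPlus M a)) β

/-- **Registered helper `stub_kerrIsometryRigidity_of_extension_and_rigidity`** — stub 1R reduced to F3 and F4
ALONE (given the three printed facts): with end matching proved (`kerrEndMatching_of_killingAlgebras`), the
registered statement `Sig4.stub_kerrIsometryRigidity` follows from the Killing algebras of Kerr and Schwarzschild,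
the backwards isometry, the horizon extension `KerrHorizonExtension` and the asymptotic rigidity
`KerrAsymptoticRigidity` (`stub_kerrIsometryRigidity_of_horizonExtension`). Chruściel–Costa arXiv:0806.0016,
Thm. 1.3. [folklore] -/
theorem stub_kerrIsometryRigidity_of_extension_and_rigidity : ONeill1995_kerrKillingFields → StephaniEtAl2003_schwarzschildKillingFields → ONeill1995_kerrBackwardsIsometry → KerrHorizonExtension → KerrAsymptoticRigidity → Sig4.stub_kerrIsometryRigidity :=
  fun h1 h2 h3 h4 h5 ↦ stub_kerrIsometryRigidity_of_horizonExtension h1 h2 h3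
    (kerrEndMatching_of_killingAlgebras h1 h2) h4 h5

end Summit.FinalStateConjecture.FinalStateConjecture.Theorems.SymplecticDualOfTheBomb

end
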